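import Summits.QuantumFields.YangMills.Theorems.BalabanUVNodesN19ContinuumStringFieldLaw
import Summits.QuantumFields.YangMills.Theorems.BalabanUVNodesN19ExpectationCurrencyTwoConstantsRate
import Summits.QuantumFields.YangMills.Theorems.BalabanUVNodesN19LawPriceAtSchemeRate

/-!
# YM-DAG node N19 (= NE7 proper) — THE CONTINUUM STRING FIELD IS A RANDOM MULTIPLICATIVE FUNCTIONAL; its marginals; a UNIFORM cylinder-moment rate

Cell `pub-ymgap`, HUMAN RULING D-0062 (Track A), R141 (C) wider-strategy seat `pub-ymgap-dag-n19-e` (strategy s3 = ALTERNATIVE CURRENCY), generation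
g19, module 2 (lineage module 54).  Route `Summits/QuantumFields/YangMills/Theses/BalabanUVNodes.lean` rev 25, cluster item K3⁷ «SpineGivenEndpointR13SepCoPH»
(stmt-QuantumFields-20544, dag-lead WORDS-143); filed `--supports` that item `--as helper` (it proves no registered stub).  COUNT-NEUTRAL: [folklore] measure
theory over Mathlib (`integral_eq_zero_iff_of_nonneg`, `ae_all_iff`) + the seat's p564785 `…N19ContinuumStringFieldLaw` (module 53: the string-field law,
`tendsto_expectAt_integral_coord`, `prodObs_finsuppString`), p505344 `…N19ContinuumLawAtScheme` (`continuumLaw_unique`, `genFunLim_eq_cgf_of_continuumLaw`)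
and p482030 `…N19ExpectationCurrencyTwoConstantsRate` (`abs_expectAt_sub_lim_le_linlog_tail_of_target`) BY NAME; `Spine.NE7.Target` (N19's DECL-target
shape, NOT PRINTED, NOT proved) and the law hypotheses are HYPOTHESES; no Theses import; NOT a discharge claim.

THE POINT.  Module 53 packaged `HasContinuumLimit S` as ONE probability law `ν` on `ℝ^{List O}` receiving `∫ F((∏os)_{os}) dgibbs_K → ∫ F dν` for every
continuous `F`.  What distinguishes `ν` from an arbitrary process law is the algebra of strings, and it passes to the limit:
* ★ `ae_eq_zero_of_vanishing_along_scheme` — TRANSFER: a continuous functional vanishing identically on the string field at every step vanishes `ν`-a.s.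
  (test `min |F| 1`, `integral_eq_zero_iff_of_nonneg`).
* ★★ `ae_multiplicative_stringFieldLaw` — since `∏(os ++ os') = ∏os · ∏os'` and `∏[] = 1` pointwise at every `K` (`prodObs_append`), `ν`-almost every
  `x : List O → ℝ` is a MONOID HOMOMORPHISM from the free monoid of observable labels to `([−1,1], ·)`: `x [] = 1`, `x (os ++ os') = x os · x os'`,
  `|x os| ≤ 1` — the continuum string field is a random multiplicative functional (and so every cylinder monomial is ITSELF a coordinate `ν`-a.s.:
  `ae_finsuppProd_eq_coord`).
* ★ `map_eval_stringFieldLaw` — the one-dimensional marginal of `ν` at a string `os` IS g9's continuum law of `∏os` (p505344 `continuumLaw_unique`), so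
  `genFunLim (schemeZ S os) = cgf id (ν.map (· os))` at every real source (`genFunLim_eq_cgf_marginal`): the seat's whole one-string theory (p480837 …
  p561078) is the theory of `ν`'s marginals.
* ★★ `abs_cylinderMoment_sub_integral_le_of_uniformTarget` — a first QUANTITATIVE statement about joint laws: under N19's DECL-target shape for EVERY string
  with COMMON data (`∀ os, Spine.NE7.Target vol l₀ δ (schemeZ S os)`, `0 < l₀` — a HYPOTHESIS), every cylinder MOMENT of the string field is within
  `(4e^{1+l₀}∕l₀)·τ_K·(1 + log⁺ τ_K⁻¹)`, `τ_K = Σ_m 2·vol·δ_{K+m}`, of its continuum value — ONE rate for all monomials of all orders in all strings (each is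
  the expectation of one concatenated string, p482030's rate under `Target` is string-independent, and the continuum value is a coordinate mean of `ν` by
  multiplicativity).  NOT claimed: a bounded-Lipschitz rate for general cylinder functionals of `d ≥ 2` strings (needs a multivariate Jackson ∕ Bernstein
  constant; for `d = 1` it is p556871's `log(e+L_K)∕(1+L_K)`).

HONEST FRAMING (binding).  [folklore] ∕ bookkeeping; NO consumer in the DAG today.  `ν` is a typed RESTATEMENT DEVICE for the string-indexed limits (dag-lead
guard, DEDUP 19:47Z): it packages `HasContinuumLimit` ∕ uniform `Target`, proves nothing about them; nothing of Bałaban's is instantiated; NE7 NOT PRINTED, NOT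
proved; N19 NOT discharged; count-neutral.  One finite `T⁴` programme at fixed `ε` → 0 at FIXED volume; NOT a continuum ∕ `ℝ⁴` ∕ infinite-volume ∕ OS ∕
mass-gap ∕ Clay statement.  0 `def` ∕ 0 `sorry`.
-/

noncomputable section

open Set Filter Topology MeasureTheory ProbabilityTheory

namespace Summit.QuantumFields.YangMills.Theorems.BalabanUVNodesN19ContinuumStringFieldStructure

open Literature.MathematicalPhysics.QuantumFieldTheory.Balaban1983to89
open T4CauchySum (genFun genFunLim abs_genFun_sub_lim_le)
open T4GenFunBounds (prodObs gibbsMeasure schemeZ expectAt_eq_integral_gibbs)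
open Missing (TorusScheme HasContinuumLimit)
open Summit.QuantumFields.BalabanUV.T4Continuum.Spine
open Summit.QuantumFields.YangMills.Theorems.BalabanUVNodesN19ContinuumJointLaws (prodObs_append prodObs_flatten prodObs_replicate_flatten)
open Summit.QuantumFields.YangMills.BalabanUVNodes.N19ContinuumLawAtScheme (continuumLaw_unique genFunLim_eq_cgf_of_continuumLaw)
open Summit.QuantumFields.YangMills.Theorems.BalabanUVNodesN19ContinuumStringFieldLaw
  (continuous_finsuppProd_pow prodObs_finsuppString exists_stringFieldLaw_of_hasContinuumLimit tendsto_expectAt_integral_coord)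
open Summit.QuantumFields.YangMills.BalabanUVNodes.N19ExpectationCurrencyTwoConstantsRate (abs_expectAt_sub_lim_le_linlog_tail_of_target)
open Summit.QuantumFields.YangMills.Theorems.BalabanUVNodesN19LawPriceAtSchemeRate (abs_integral_prodObs_sub_continuumLaw_le_logRate)

/-! ## §0 Deterministic: multiplicative functionals on the free monoid `List O` -/

section Algebra

variable {O : Type*}

/-- A multiplicative functional on lists with `x [] = 1` turns flattening into products. [bookkeeping] -/
theorem apply_flatten_of_multiplicative {x : List O → ℝ} (h0 : x [] = 1) (hmul : ∀ os os', x (os ++ os') = x os * x os')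
    (L : List (List O)) : x L.flatten = (L.map x).prod := by
  induction L with
  | nil => simpa using h0
  | cons os L ih => rw [List.flatten_cons, hmul, ih, List.map_cons, List.prod_cons]

/-- … repeated strings into powers … [bookkeeping] -/
theorem apply_replicate_flatten_of_multiplicative {x : List O → ℝ} (h0 : x [] = 1) (hmul : ∀ os os', x (os ++ os') = x os * x os')
    (os : List O) (n : ℕ) : x (List.replicate n os).flatten = x os ^ n := by
  rw [apply_flatten_of_multiplicative h0 hmul, List.map_replicate, List.prod_replicate]

/-- … and every cylinder monomial `∏_{os} x_{os}^{k os}` (`k` finitely supported) into ONE coordinate: the concatenated string. [bookkeeping] -/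
theorem finsuppProd_eq_apply_of_multiplicative {x : List O → ℝ} (h0 : x [] = 1) (hmul : ∀ os os', x (os ++ os') = x os * x os')
    (k : List O →₀ ℕ) :
    k.prod (fun os e => x os ^ e) = x ((k.support.toList.map fun os => (List.replicate (k os) os).flatten).flatten) := by
  rw [apply_flatten_of_multiplicative h0 hmul, List.map_map, Finsupp.prod, ← Finset.prod_map_toList]
  congr 1
  refine List.map_congr_left fun os _ => ?_
  simp only [Function.comp_apply, apply_replicate_flatten_of_multiplicative h0 hmul]

end Algebra

section Scheme

variable {G : Type*} [GaugeGroup G] [MeasurableSpace G] [RegularGaugeGroup G] [HaarData G] {O : Type*}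
  (S : TorusScheme G O) (hβ : ∀ K, 0 ≤ S.β K) (hm : ∀ K o, Measurable (S.obs K o))
  (h1 : ∀ K o U, |S.obs K o U| ≤ 1)

/-! ## §1 Transfer: identities of the string field pass to the continuum law; the continuum string field is multiplicative a.s. -/

omit [GaugeGroup G] [MeasurableSpace G] [RegularGaugeGroup G] [HaarData G] in
/-- The empty string's observable is `1`. [bookkeeping] -/
theorem prodObs_nil (K : ℕ) (U : GaugeField (S.P K) 0 G) : prodObs S K ([] : List O) U = 1 := by
  simp [prodObs]

omit [RegularGaugeGroup G] in
/-- ★ **TRANSFER PRINCIPLE** [folklore]: if a probability law `ν` on `ℝ^{List O}` receives the limits of all continuous functionals of the string field and a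
continuous functional `F` VANISHES IDENTICALLY on the string field at every step (`F((∏os(U))_{os}) = 0` for all `K`, `U`), then `F = 0` `ν`-almost surely
(test the bounded continuous `min |F| 1 ≥ 0`: its integrals are `0` along the scheme, hence `∫ min |F| 1 dν = 0`, hence it vanishes a.e. —
`integral_eq_zero_iff_of_nonneg`). -/
theorem ae_eq_zero_of_vanishing_along_scheme [Countable O] (ν : Measure (List O → ℝ)) [IsProbabilityMeasure ν]
    (hν : ∀ F : (List O → ℝ) → ℝ, Continuous F →
      Tendsto (fun K => ∫ U, F (fun os => prodObs S K os U) ∂gibbsMeasure (S.P K) (S.β K)) atTop (𝓝 (∫ x, F x ∂ν)))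
    {F : (List O → ℝ) → ℝ} (hF : Continuous F) (h0 : ∀ K U, F (fun os => prodObs S K os U) = 0) : ∀ᵐ x ∂ν, F x = 0 := by
  let G' : (List O → ℝ) → ℝ := fun x => min |F x| 1
  have hG : Continuous G' := (continuous_abs.comp hF).min continuous_const
  have hG0 : ∀ x, 0 ≤ G' x := fun x => le_min (abs_nonneg _) zero_le_one
  have hG1 : ∀ x, G' x ≤ 1 := fun x => min_le_right _ _
  have hlim : Tendsto (fun K => ∫ U, G' (fun os => prodObs S K os U) ∂gibbsMeasure (S.P K) (S.β K)) atTop (𝓝 (∫ x, G' x ∂ν)) := hν G' hG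
  have hzero : ∫ x, G' x ∂ν = 0 := by
    refine tendsto_nhds_unique hlim (tendsto_const_nhds.congr fun K => ?_)
    refine (integral_eq_zero_of_ae (ae_of_all _ fun U => ?_)).symm
    simp only [G', h0 K U, abs_zero, Pi.zero_apply]
    exact min_eq_left zero_le_one
  have hint : Integrable G' ν := (integrable_const (1 : ℝ)).mono' hG.aestronglyMeasurable
    (ae_of_all _ fun x => by rw [Real.norm_eq_abs, abs_of_nonneg (hG0 x)]; exact hG1 x)
  have hae : G' =ᵐ[ν] 0 := (integral_eq_zero_iff_of_nonneg (fun x => hG0 x) hint).1 hzero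
  filter_upwards [hae] with x hx
  have hx' : min |F x| 1 = 0 := hx
  rcases min_choice |F x| 1 with h | h
  · exact abs_eq_zero.1 (h ▸ hx')
  · exact absurd (h ▸ hx') one_ne_zero

omit [RegularGaugeGroup G] in
/-- **★★ THE CONTINUUM STRING FIELD IS A RANDOM MULTIPLICATIVE FUNCTIONAL** [folklore].  For a torus scheme with `β_K ≥ 0` and countably many observable labels,
if a probability law `ν` on `ℝ^{List O}` carried by the cube `[−1,1]^{List O}` receives the limits of all continuous functionals of the string field, then
`ν`-almost every `x` is a monoid homomorphism from the free monoid `List O` to `([−1,1], ·)`: `x [] = 1`, `x (os ++ os') = x os · x os'` for ALL strings,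
`|x os| ≤ 1` — the identities `∏[] = 1`, `∏(os ++ os') = ∏os · ∏os'` hold pointwise at every step (p558060 `prodObs_append`) and transfer (previous theorem;
countably many identities, `ae_all_iff`). -/
theorem ae_multiplicative_stringFieldLaw [Countable O] (ν : Measure (List O → ℝ)) [IsProbabilityMeasure ν]
    (hν1 : ν (Set.pi Set.univ (fun _ : List O => Icc (-1) 1))ᶜ = 0)
    (hν : ∀ F : (List O → ℝ) → ℝ, Continuous F →
      Tendsto (fun K => ∫ U, F (fun os => prodObs S K os U) ∂gibbsMeasure (S.P K) (S.β K)) atTop (𝓝 (∫ x, F x ∂ν))) :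
    ∀ᵐ x ∂ν, x [] = 1 ∧ (∀ os os' : List O, x (os ++ os') = x os * x os') ∧ ∀ os, |x os| ≤ 1 := by
  have hnil : ∀ᵐ x ∂ν, x [] = 1 := by
    have h := ae_eq_zero_of_vanishing_along_scheme S ν hν (F := fun x => x [] - 1) ((continuous_apply _).sub continuous_const)
      fun K U => by simp [prodObs_nil]
    filter_upwards [h] with x hx using sub_eq_zero.1 hx
  have hmul : ∀ᵐ x ∂ν, ∀ os os' : List O, x (os ++ os') = x os * x os' := by
    refine ae_all_iff.2 fun os => ae_all_iff.2 fun os' => ?_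
    have h := ae_eq_zero_of_vanishing_along_scheme S ν hν (F := fun x => x (os ++ os') - x os * x os')
      ((continuous_apply _).sub ((continuous_apply _).mul (continuous_apply _))) fun K U => by simp [prodObs_append]
    filter_upwards [h] with x hx using sub_eq_zero.1 hx
  have hcube : ∀ᵐ x ∂ν, ∀ os, |x os| ≤ 1 := by
    have h : ∀ᵐ x ∂ν, x ∈ Set.pi Set.univ (fun _ : List O => Icc (-1 : ℝ) 1) := mem_ae_iff.2 hν1
    filter_upwards [h] with x hx using fun os => abs_le.2 (Set.mem_univ_pi.1 hx os)
  filter_upwards [hnil, hmul, hcube] with x h₁ h₂ h₃ using ⟨h₁, h₂, h₃⟩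

omit [RegularGaugeGroup G] in
/-- **★ … SO EVERY CYLINDER MONOMIAL IS A COORDINATE `ν`-a.s.**: `∏_{os} x_{os}^{k os} = x_{concatenated string}` for `ν`-a.e. `x`, hence
`∫ ∏_{os} x_{os}^{k os} dν = ∫ x_{concat} dν` — the mixed moments of `ν` are coordinate means. [bookkeeping] -/
theorem integral_finsuppProd_eq_integral_coord [Countable O] (ν : Measure (List O → ℝ)) [IsProbabilityMeasure ν]
    (hν1 : ν (Set.pi Set.univ (fun _ : List O => Icc (-1) 1))ᶜ = 0)
    (hν : ∀ F : (List O → ℝ) → ℝ, Continuous F →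
      Tendsto (fun K => ∫ U, F (fun os => prodObs S K os U) ∂gibbsMeasure (S.P K) (S.β K)) atTop (𝓝 (∫ x, F x ∂ν)))
    (k : List O →₀ ℕ) :
    ∫ x, k.prod (fun os e => x os ^ e) ∂ν = ∫ x, x ((k.support.toList.map fun os => (List.replicate (k os) os).flatten).flatten) ∂ν := by
  refine integral_congr_ae ?_
  filter_upwards [ae_multiplicative_stringFieldLaw S ν hν1 hν] with x hx
  exact finsuppProd_eq_apply_of_multiplicative hx.1 hx.2.1 k

/-! ## §2 Marginals: the one-string theory is the theory of `ν`'s marginals -/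

omit [RegularGaugeGroup G] in
/-- **★ THE MARGINAL OF THE STRING-FIELD LAW AT A STRING IS g9's CONTINUUM LAW OF THAT STRING** [bookkeeping]: `ν.map (· os)` is a probability law on `ℝ`
carried by `[−1,1]` receiving `∫ f(∏os) dgibbs_K → ∫ f d(ν.map (· os))` for every continuous `f` — hence equal to ANY law receiving these limits (p505344
`continuumLaw_unique`), in particular to p505344's `continuumLaw_of_target` under `Target`. -/
theorem map_eval_stringFieldLaw (ν : Measure (List O → ℝ)) [IsProbabilityMeasure ν]
    (hν1 : ν (Set.pi Set.univ (fun _ : List O => Icc (-1) 1))ᶜ = 0)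
    (hν : ∀ F : (List O → ℝ) → ℝ, Continuous F →
      Tendsto (fun K => ∫ U, F (fun os => prodObs S K os U) ∂gibbsMeasure (S.P K) (S.β K)) atTop (𝓝 (∫ x, F x ∂ν))) (os : List O) :
    IsProbabilityMeasure (ν.map fun x => x os) ∧ (ν.map fun x => x os) (Icc (-1) 1)ᶜ = 0 ∧
      (∀ f : ℝ → ℝ, Continuous f →
        Tendsto (fun K => ∫ U, f (prodObs S K os U) ∂gibbsMeasure (S.P K) (S.β K)) atTop (𝓝 (∫ y, f y ∂(ν.map fun x => x os)))) ∧
      ∀ ν₁ : Measure ℝ, IsProbabilityMeasure ν₁ →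
        (∀ f : ℝ → ℝ, Continuous f → Tendsto (fun K => ∫ U, f (prodObs S K os U) ∂gibbsMeasure (S.P K) (S.β K)) atTop (𝓝 (∫ y, f y ∂ν₁))) →
          ν₁ = ν.map fun x => x os := by
  have hev : Measurable fun x : List O → ℝ => x os := measurable_pi_apply os
  haveI : IsProbabilityMeasure (ν.map fun x => x os) := Measure.isProbabilityMeasure_map hev.aemeasurable
  have hlim : ∀ f : ℝ → ℝ, Continuous f →
      Tendsto (fun K => ∫ U, f (prodObs S K os U) ∂gibbsMeasure (S.P K) (S.β K)) atTop (𝓝 (∫ y, f y ∂(ν.map fun x => x os))) := fun f hf => by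
    rw [integral_map hev.aemeasurable hf.aestronglyMeasurable]
    exact hν (fun x => f (x os)) (hf.comp (continuous_apply os))
  refine ⟨inferInstance, ?_, hlim, fun ν₁ i₁ h₁ => continuumLaw_unique S os ν₁ _ h₁ hlim⟩
  rw [Measure.map_apply hev measurableSet_Icc.compl]
  refine measure_mono_null (fun x hx => ?_) hν1
  simp only [mem_preimage, mem_compl_iff] at hx ⊢
  exact fun h => hx (Set.mem_univ_pi.1 h os)

include hβ hm h1

/-- **★ THE CONTINUUM GENERATING FUNCTION OF A STRING IS THE CGF OF `ν`'s MARGINAL**: `genFunLim (schemeZ S os) t = cgf id (ν.map (· os)) t` at every real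
source `t` (p505344 `genFunLim_eq_cgf_of_continuumLaw` on the marginal), and `S.expectAt K os → ∫ x_{os} dν`. [bookkeeping] -/
theorem genFunLim_eq_cgf_marginal (ν : Measure (List O → ℝ)) [IsProbabilityMeasure ν]
    (hν1 : ν (Set.pi Set.univ (fun _ : List O => Icc (-1) 1))ᶜ = 0)
    (hν : ∀ F : (List O → ℝ) → ℝ, Continuous F →
      Tendsto (fun K => ∫ U, F (fun os => prodObs S K os U) ∂gibbsMeasure (S.P K) (S.β K)) atTop (𝓝 (∫ x, F x ∂ν))) (os : List O) (t : ℝ) :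
    genFunLim (schemeZ S os) t = cgf id (ν.map fun x => x os) t ∧ Tendsto (fun K => S.expectAt K os) atTop (𝓝 (∫ x, x os ∂ν)) := by
  obtain ⟨_, -, hlim, -⟩ := map_eval_stringFieldLaw S ν hν1 hν os
  exact ⟨(genFunLim_eq_cgf_of_continuumLaw S hβ hm h1 os _ hlim t).2, tendsto_expectAt_integral_coord S hβ ν hν os⟩

/-! ## §3 Under N19's DECL-target shape for EVERY string with common data: existence, and ONE rate for ALL cylinder moments -/

/-- Uniform `Target` ⇒ `HasContinuumLimit` (each string's expectations converge, p482030). [bookkeeping] -/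
theorem hasContinuumLimit_of_uniformTarget {vol l₀ : ℝ} {δ : ℕ → ℝ} (hl₀ : 0 < l₀) (hT : ∀ os : List O, NE7.Target vol l₀ δ (schemeZ S os)) :
    HasContinuumLimit S := fun os => by
  obtain ⟨E, hE, -⟩ := abs_expectAt_sub_lim_le_linlog_tail_of_target S hβ hm h1 hl₀ os (hT os)
  exact ⟨E, hE⟩

/-- **★ THE STRING-FIELD LAW UNDER UNIFORM `Target`** (module 53 + the previous lemma): countably many labels, `∀ os, Spine.NE7.Target vol l₀ δ (schemeZ S os)`,
`0 < l₀` ⇒ the unique string-field law `ν` exists. [bookkeeping] -/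
theorem exists_stringFieldLaw_of_uniformTarget [Countable O] {vol l₀ : ℝ} {δ : ℕ → ℝ} (hl₀ : 0 < l₀)
    (hT : ∀ os : List O, NE7.Target vol l₀ δ (schemeZ S os)) :
    ∃ ν : Measure (List O → ℝ), IsProbabilityMeasure ν ∧ ν (Set.pi Set.univ (fun _ : List O => Icc (-1) 1))ᶜ = 0 ∧
      ∀ F : (List O → ℝ) → ℝ, Continuous F →
        Tendsto (fun K => ∫ U, F (fun os => prodObs S K os U) ∂gibbsMeasure (S.P K) (S.β K)) atTop (𝓝 (∫ x, F x ∂ν)) := by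
  obtain ⟨ν, iν, hν1, hν, -⟩ := exists_stringFieldLaw_of_hasContinuumLimit S hβ hm h1 (hasContinuumLimit_of_uniformTarget S hβ hm h1 hl₀ hT)
  exact ⟨ν, iν, hν1, hν⟩

/-- **★★ ONE RATE FOR EVERY COORDINATE MEAN** [bookkeeping over p482030]: under uniform `Target` (`0 < l₀`), if `ν` receives the limits of all continuous
functionals of the string field, then for EVERY string `os` and every `K`,
`|S.expectAt K os − ∫ x_{os} dν| ≤ (4e^{1+l₀}∕l₀)·τ_K·(1 + log⁺ τ_K⁻¹)`, `τ_K = Σ_m 2·vol·δ_{K+m}` — the same bound for all strings (p482030's rate under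
`Target` does not see the string; its limit `E` is `ν`'s coordinate mean by uniqueness of limits). -/
theorem abs_expectAt_sub_integral_coord_le_of_uniformTarget {vol l₀ : ℝ} {δ : ℕ → ℝ} (hl₀ : 0 < l₀)
    (hT : ∀ os : List O, NE7.Target vol l₀ δ (schemeZ S os)) (ν : Measure (List O → ℝ))
    (hν : ∀ F : (List O → ℝ) → ℝ, Continuous F →
      Tendsto (fun K => ∫ U, F (fun os => prodObs S K os U) ∂gibbsMeasure (S.P K) (S.β K)) atTop (𝓝 (∫ x, F x ∂ν))) (os : List O) (K : ℕ) :
    |S.expectAt K os - ∫ x, x os ∂ν| ≤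
      4 * Real.exp (1 + l₀) / l₀ * (∑' m, 2 * (vol * δ (K + m))) * (1 + Real.posLog (∑' m, 2 * (vol * δ (K + m)))⁻¹) := by
  obtain ⟨E, hE, hrate⟩ := abs_expectAt_sub_lim_le_linlog_tail_of_target S hβ hm h1 hl₀ os (hT os)
  rw [← tendsto_nhds_unique hE (tendsto_expectAt_integral_coord S hβ ν hν os)]
  exact hrate K

/-- **★★ ONE RATE FOR EVERY CYLINDER MOMENT OF THE STRING FIELD** [bookkeeping]: under uniform `Target` (`0 < l₀`, countably many labels), if `ν` is carried by
the cube and receives the limits of all continuous functionals, then for EVERY finitely supported exponent `k : List O →₀ ℕ` and every `K`,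
`|∫ ∏_{os}(∏os)^{k os} dgibbs_K − ∫ ∏_{os} x_{os}^{k os} dν| ≤ (4e^{1+l₀}∕l₀)·τ_K·(1 + log⁺ τ_K⁻¹)` — uniformly in the strings AND in the order of the
monomial: the monomial is the observable of ONE concatenated string (module 53 `prodObs_finsuppString`), whose expectation obeys the previous bound, and its
`ν`-integral is that string's coordinate mean because `ν` is multiplicative a.s. (§1).  NOT claimed: a bounded-Lipschitz rate for general cylinder
functionals of several strings (a multivariate approximation constant is needed). -/
theorem abs_cylinderMoment_sub_integral_le_of_uniformTarget [Countable O] {vol l₀ : ℝ} {δ : ℕ → ℝ} (hl₀ : 0 < l₀)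
    (hT : ∀ os : List O, NE7.Target vol l₀ δ (schemeZ S os)) (ν : Measure (List O → ℝ)) [IsProbabilityMeasure ν]
    (hν1 : ν (Set.pi Set.univ (fun _ : List O => Icc (-1) 1))ᶜ = 0)
    (hν : ∀ F : (List O → ℝ) → ℝ, Continuous F →
      Tendsto (fun K => ∫ U, F (fun os => prodObs S K os U) ∂gibbsMeasure (S.P K) (S.β K)) atTop (𝓝 (∫ x, F x ∂ν)))
    (k : List O →₀ ℕ) (K : ℕ) :
    |∫ U, k.prod (fun os e => prodObs S K os U ^ e) ∂gibbsMeasure (S.P K) (S.β K) - ∫ x, k.prod (fun os e => x os ^ e) ∂ν| ≤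
      4 * Real.exp (1 + l₀) / l₀ * (∑' m, 2 * (vol * δ (K + m))) * (1 + Real.posLog (∑' m, 2 * (vol * δ (K + m)))⁻¹) := by
  set osk : List O := (k.support.toList.map fun os => (List.replicate (k os) os).flatten).flatten with hosk
  have hE : ∫ U, k.prod (fun os e => prodObs S K os U ^ e) ∂gibbsMeasure (S.P K) (S.β K) = S.expectAt K osk := by
    rw [expectAt_eq_integral_gibbs S hβ K]
    exact (integral_congr_ae (ae_of_all _ fun U => prodObs_finsuppString S K k U)).symm
  rw [hE, integral_finsuppProd_eq_integral_coord S ν hν1 hν k]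
  exact abs_expectAt_sub_integral_coord_le_of_uniformTarget S hβ hm h1 hl₀ hT ν hν osk K

/-- **★ MATCHING MODULO CONSTANTS AGAINST THE CONTINUUM, EVERY STRING AT ONCE** [bookkeeping over `T4CauchySum.abs_genFun_sub_lim_le`]: under uniform
`Target` (`0 < l₀`), if `ν` is carried by the cube and receives the limits of all continuous functionals, then for every string `os`, every source
`|t| ≤ l₀` and every `K`, `|genFun (schemeZ S os) K t − cgf id (ν.map (· os)) t| ≤ τ_K` — the step-`K` generating function of EVERY string is within the
tail `τ_K = Σ_m 2·vol·δ_{K+m}` of the cgf of the corresponding marginal of the ONE law `ν` (N19's DECL-target shape read against `K = ∞`). -/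
theorem abs_genFun_sub_cgf_marginal_le_of_uniformTarget {vol l₀ : ℝ} {δ : ℕ → ℝ} (hl₀ : 0 < l₀)
    (hT : ∀ os : List O, NE7.Target vol l₀ δ (schemeZ S os)) (ν : Measure (List O → ℝ)) [IsProbabilityMeasure ν]
    (hν1 : ν (Set.pi Set.univ (fun _ : List O => Icc (-1) 1))ᶜ = 0)
    (hν : ∀ F : (List O → ℝ) → ℝ, Continuous F →
      Tendsto (fun K => ∫ U, F (fun os => prodObs S K os U) ∂gibbsMeasure (S.P K) (S.β K)) atTop (𝓝 (∫ x, F x ∂ν)))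
    (os : List O) {t : ℝ} (ht : |t| ≤ l₀) (K : ℕ) :
    |genFun (schemeZ S os) K t - cgf id (ν.map fun x => x os) t| ≤ ∑' m, 2 * (vol * δ (K + m)) := by
  rw [← (genFunLim_eq_cgf_marginal S hβ hm h1 ν hν1 hν os t).1]
  exact abs_genFun_sub_lim_le (hT os).1 hl₀.le (hT os).2 ht K

/-- **★★ ONE LAW-LEVEL RATE FOR EVERY ONE-DIMENSIONAL MARGINAL** [bookkeeping over p556871 `abs_integral_prodObs_sub_continuumLaw_le_logRate`]: under uniform
`Target` (`0 < l₀`, countable labels), with `ν` as above, for EVERY string `os`, every `Kg`-Lipschitz `g` with `|g| ≤ Gb` on `[−1,1]` and every `K` with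
`τ_K ≤ 1`: `|∫ g(∏os) dgibbs_K − ∫ g(x_{os}) dν(x)| ≤ 384·c(l₀)·(Kg + Gb)·log(e+L_K)∕(1+L_K)`, `L_K = log⁺ τ_K⁻¹`, `c(l₀) = 6 + l₀ + log max(1, 4e∕l₀)` — the
seat's sharp one-string law price, now uniformly over the strings of the one law `ν` (its marginal at `os` is g9's continuum law, §2).  NOT claimed: a rate
for functionals of several coordinates. -/
theorem abs_integral_comp_eval_sub_le_logRate_of_uniformTarget {vol l₀ : ℝ} {δ : ℕ → ℝ} (hl₀ : 0 < l₀)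
    (hT : ∀ os : List O, NE7.Target vol l₀ δ (schemeZ S os)) (ν : Measure (List O → ℝ)) [IsProbabilityMeasure ν]
    (hν1 : ν (Set.pi Set.univ (fun _ : List O => Icc (-1) 1))ᶜ = 0)
    (hν : ∀ F : (List O → ℝ) → ℝ, Continuous F →
      Tendsto (fun K => ∫ U, F (fun os => prodObs S K os U) ∂gibbsMeasure (S.P K) (S.β K)) atTop (𝓝 (∫ x, F x ∂ν)))
    (os : List O) {g : ℝ → ℝ} {Kg : NNReal} (hg : LipschitzWith Kg g) {Gb : ℝ} (hG : ∀ x ∈ Icc (-1 : ℝ) 1, |g x| ≤ Gb) (K : ℕ)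
    (hτ1 : ∑' m, 2 * (vol * δ (K + m)) ≤ 1) :
    |∫ U, g (prodObs S K os U) ∂gibbsMeasure (S.P K) (S.β K) - ∫ x, g (x os) ∂ν| ≤
      384 * (6 + l₀ + Real.log (max 1 (4 * Real.exp 1 / l₀))) * (Kg + Gb) *
        (Real.log (Real.exp 1 + Real.posLog (∑' m, 2 * (vol * δ (K + m)))⁻¹) /
          (1 + Real.posLog (∑' m, 2 * (vol * δ (K + m)))⁻¹)) := by
  obtain ⟨_, hc, hlim, -⟩ := map_eval_stringFieldLaw S ν hν1 hν os
  have h := abs_integral_prodObs_sub_continuumLaw_le_logRate S hβ hm h1 hl₀ os (hT os) (ν.map fun x => x os) hc hlim hg hG K hτ1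
  rwa [integral_map (measurable_pi_apply os).aemeasurable hg.continuous.aestronglyMeasurable] at h

end Scheme

end Summit.QuantumFields.YangMills.Theorems.BalabanUVNodesN19ContinuumStringFieldStructure

end
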